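import Literature.Analysis.FluidPDE.AxisymQuotientEquations
import HarnessLib

/-!
# The equation of `Ω = ω^θ/r` for axisymmetric Navier–Stokes flows (Lei–Zhang 2017, (1.4)₂),
# as an identity of smooth functions on `ℝ³`

Analysis/FluidPDE proof file (theorems only; no definitions, no named facts), sequel of
`AxisymQuotientEquations.lean` (the `Φ`-equation), on the discharge path of the named facts
`Literature.Analysis.FluidPDE.LeiZhang2017_logModulus_regularity`,
`…LeiZhang2017_smallSwirl_regularity` and `…Wei2016_logModulus_regularity`:

> "`∂ₜΩ + (b·∇)Ω = (Δ + (2/r)∂ᵣ)Ω − 2 (v^θ/r) J`", `Ω = ω^θ/r`, `J = −∂_z v^θ/r = ωʳ/r`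
> (Lei–Zhang 2017, arXiv:1505.02628, (1.4), p. 4; Wei 2016, (1.5); Chen–Fang–Zhang 2017).

With the smooth Hou–Li variables `Ω = angVortQuot u = radQuot (swirl (curl u))`,
`Φ = angVelQuot u = v^θ/r`, `W = radVelQuot u = vʳ/r` and `J = radVelQuot (curl u) = ωʳ/r`
(`AxisymHouLiVariables.lean`, smooth across the axis), this file proves for a classical solution of
the unforced system with viscosity `ν` on a time set `S ⊆ closure (interior S)` of unique
differentiability (e.g. `Icc a b`, `a < b`) with axisymmetric velocity, at every `t ∈ S` and
EVERY `x`: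

* `IsClassicalNSSolutionOn.angVortQuot_eq` — `Ω'(x) + DΩ(x)[u] = ν (ΔΩ(x) + 2 radDerivQuot Ω (x))
  − 2 Φ(x) J(x)`, where `Ω' = angVortQuot (∂ₜu t)` is the smooth quotient of
  `∂ₜ swirl (curl u) = swirl (curl ∂ₜu)` (mixed partials commute,
  `IsSmoothSpaceTimeOn.timeDerivWithin_fderiv_slice_apply`).

Proof: `IsClassicalNSSolutionOn.swirl_vorticity_transport` gives, for `Σ = swirl (curl u) = ρ Ω`
(`ρ = r²`), `Σ' + DΣ[u] = 2⟪J u, ω⟫ + ν ⟪Jx, Δω⟫`; here `⟪Jx, Δω⟫ = ΔΣ − (2/ρ) DΣ[x_h]` for the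
axisymmetric field `ω` (`laplacian_swirl`, `IsAxisymmetric.partialDeriv_eR_swirl`), and by
Lagrange's identity (`cylRadius_sq_mul_inner_rotGen`) `2⟪J u, ω⟫ = 2ρ (W Ω − Φ J)`; the
template `template_quotient_eq` turns this into
`Ω' + DΩ[u] + 2ΩW = ν (ΔΩ + (2/ρ) DΩ[x_h]) + 2 (W Ω − Φ J)` — the `WΩ` terms cancel (the classical
cancellation `ωʳ`-free form of (1.4)₂).  Off the axis first, then everywhere by continuity.

## Mathlib / tree search

Tree: `AxisymQuotientEquations` (template, `Φ`-equation, `ρ`-calculus, axisymmetry of `∂ₜu`),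
`IsClassicalNSSolutionOn.swirl_vorticity_transport`, `cylRadius_sq_mul_inner_rotGen`,
`IsSmoothSpaceTimeOn.isSmoothSpaceTimeOn_vorticity`, `IsAxisymmetric.curl`
(`AxisymmetricVorticityTransport`), `laplacian_swirl`, `IsAxisymmetric.partialDeriv_eR_swirl`,
`timeDerivWithin_swirl` (`SwirlTransportProofs`), `IsAxisymmetric.cylRadius_sq_mul_angVortQuot /
_angVelQuot / _radVelQuot` (`AxisymHouLiVariables`), `IsSmoothSpaceTimeOn.timeDerivWithin_fderiv_slice_apply`
(`EnergyToolkit`), `eq_of_eq_off_ker` (`AxisymmetricLiftR5`).  `lean search 'angVortQuot_eq'`: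
nothing before this file.

## References

* Z. Lei, Q. S. Zhang, Pacific J. Math. 289 (2017) 169–187, arXiv:1505.02628, §1 (1.4) (p. 4).
  [`LeiZhang2017`]
* D. Wei, J. Math. Anal. Appl. 435 (2016) 402–413, arXiv:1508.03318, (1.5). [`Wei2016`]
* A. J. Majda, A. L. Bertozzi, *Vorticity and Incompressible Flow*, CUP 2002, §2.3.3 (2.58).
-/

noncomputable section

open MeasureTheory Set Function Filter Topology InnerProductSpace WithLp
open scoped RealInnerProductSpace Laplacian ContDiff

namespace Literature.Analysis.FluidPDE

section OmegaEquation

variable {S : Set ℝ} {ν : ℝ} {v : ℝ → EuclideanSpace ℝ (Fin 3) → EuclideanSpace ℝ (Fin 3)}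
  {q : ℝ → EuclideanSpace ℝ (Fin 3) → ℝ}

/-- `⟪(x₀, x₁, 0), w⟫ = x₀w₀ + x₁w₁` (private copy of
`SereginZajaczkowski2007.inner_horizontal_left`, foreign import closure). [folklore] -/
private theorem inner_toLp_horizontal_left (x w : EuclideanSpace ℝ (Fin 3)) :
    ⟪(toLp 2 ![x 0, x 1, 0] : EuclideanSpace ℝ (Fin 3)), w⟫ = x 0 * w 0 + x 1 * w 1 := by
  simp [PiLp.inner_apply, Fin.sum_univ_three]
  ring

/-- **`∂ₜ ω = curl (∂ₜ u)`**: the one-sided time derivative of the vorticity of a jointly smooth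
field on `S ⊆ closure (interior S)` is the curl of the time derivative (mixed partials commute,
`IsSmoothSpaceTimeOn.timeDerivWithin_fderiv_slice_apply`; `curl = curlCLM ∘ D`). [folklore] -/
theorem IsSmoothSpaceTimeOn.timeDerivWithin_vorticity_eq (h : IsSmoothSpaceTimeOn S v)
    (hS : UniqueDiffOn ℝ S) (hcl : S ⊆ closure (interior S)) {t : ℝ} (ht : t ∈ S) :
    FluidPDE.timeDerivWithin S (vorticity v) t = curl (FluidPDE.timeDerivWithin S v t) := by
  funext x
  have hvort : vorticity v = fun s y => curlCLM (fderiv ℝ (v s) y) := by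
    funext s y; rfl
  rw [hvort, timeDerivWithin_apply, curl_eq_curlCLM]
  have hdiff : DifferentiableWithinAt ℝ (fun s => fderiv ℝ (v s) x) S t :=
    (h.fderiv_slice hS).differentiableWithinAt_time ht x
  rw [derivWithin_clm_comp_apply curlCLM hdiff]
  congr 1
  -- `derivWithin (s ↦ D(v s)(x)) S t = D(∂ₜ v t)(x)` as continuous linear maps
  refine ContinuousLinearMap.ext fun w => ?_
  have h1 := h.timeDerivWithin_fderiv_slice_apply hS hcl ht x w
  rw [timeDerivWithin_apply] at h1
  rw [← h1]
  -- evaluation at `w` commutes with `derivWithin`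
  have h2 := derivWithin_clm_comp_apply
    (ContinuousLinearMap.apply ℝ (EuclideanSpace ℝ (Fin 3)) w) hdiff
  simpa using h2.symm

/-- **The `Ω`-equation off the axis** (Lei–Zhang 2017, (1.4)₂). [cite: LeiZhang2017, §1 (1.4) (arXiv p. 4)] -/
theorem IsClassicalNSSolutionOn.angVortQuot_eq_of_ne (hns : IsClassicalNSSolutionOn S ν 0 v q)
    (hS : UniqueDiffOn ℝ S) (hcl : S ⊆ closure (interior S))
    (hax : ∀ s ∈ S, IsAxisymmetric (v s)) {t : ℝ} (ht : t ∈ S)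
    {x : EuclideanSpace ℝ (Fin 3)} (hx : cylRadius x ≠ 0) :
    angVortQuot (timeDerivWithin S v t) x + fderiv ℝ (angVortQuot (v t)) x (v t x) =
      ν * ((Δ (angVortQuot (v t))) x + 2 * radDerivQuot (angVortQuot (v t)) x) -
        2 * angVelQuot (v t) x * radVelQuot (curl (v t)) x := by
  -- regularity
  have hsm : IsSmoothSpaceTimeOn S v := hns.smooth_velocity
  have hv : ContDiff ℝ ∞ (v t) := hns.contDiff_velocity ht
  have hv2 : ContDiff ℝ 2 (v t) := hv.of_le (by norm_cast)
  have hv3 : ContDiff ℝ 3 (v t) := hv.of_le (by norm_cast)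
  have hv5 : ContDiff ℝ 5 (v t) := hv.of_le (by norm_cast)
  have hvd : Differentiable ℝ (v t) := hv.differentiable (by simp)
  have hdv : ContDiff ℝ ∞ (timeDerivWithin S v t) := hsm.contDiff_timeDerivWithin_slice hS ht
  have hdv3 : ContDiff ℝ 3 (timeDerivWithin S v t) := hdv.of_le (by norm_cast)
  have haxt : IsAxisymmetric (v t) := hax t ht
  have haxdv : IsAxisymmetric (timeDerivWithin S v t) := hsm.isAxisymmetric_timeDerivWithin hax ht
  have hω : ContDiff ℝ ∞ (curl (v t)) := by
    rw [curl_eq_curlCLM_comp]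
    exact curlCLM.contDiff.comp (hv.fderiv_right (m := ∞) (by simp))
  have hω2 : ContDiff ℝ 2 (curl (v t)) := hω.of_le (by norm_cast)
  have hωd : Differentiable ℝ (curl (v t)) := hω.differentiable (by simp)
  have haxω : IsAxisymmetric (curl (v t)) := haxt.curl hvd
  have hΩ : ContDiff ℝ 2 (angVortQuot (v t)) := contDiff_angVortQuot (n := 2) hv5
  have hΩax : IsAxisymmetricScalar (angVortQuot (v t)) := haxt.isAxisymmetricScalar_angVortQuot hv3
  have hρx : x 0 ^ 2 + x 1 ^ 2 ≠ 0 := by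
    rwa [sq_add_sq_eq_cylRadius_sq, pow_ne_zero_iff two_ne_zero]
  -- the transport equation of `swirl (curl u)`
  have hpde := hns.swirl_vorticity_transport hS hcl (fun _ _ y => curl_zero y) hax ht x
  have hvort : vorticity v t = curl (v t) := rfl
  rw [hvort, convect_apply] at hpde
  -- (i) the time derivative: `∂ₜ swirl (curl u) = swirl (curl ∂ₜu) = ρ Ω'`
  have hωst : IsSmoothSpaceTimeOn S (vorticity v) := hsm.isSmoothSpaceTimeOn_vorticity hS
  have ht1 : FluidPDE.timeDerivWithin S (fun s => swirl (vorticity v s)) t x =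
      (x 0 ^ 2 + x 1 ^ 2) * angVortQuot (timeDerivWithin S v t) x := by
    rw [hωst.timeDerivWithin_swirl_eq_swirl ht x, hsm.timeDerivWithin_vorticity_eq hS hcl ht,
      sq_add_sq_eq_cylRadius_sq, haxdv.cylRadius_sq_mul_angVortQuot hdv3 x]
  -- (ii) the viscous term: `⟪Jx, Δω⟫ = Δ Σ − (2/ρ) DΣ[x_h]`, `Σ = swirl ω`
  have hlap := laplacian_swirl hω2 x
  have hrad := haxω.partialDeriv_eR_swirl (hωd x)
  rw [partialDeriv_apply, eR_eq_inv_smul_horizontal, map_smul, smul_eq_mul] at hrad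
  -- `hrad : r⁻¹ * D(swirl ω)[x_h] = r * (∂₀ω₁ − ∂₁ω₀)`
  have hvisc : ⟪rotGen x, (Δ (curl (v t))) x⟫ =
      (Δ (swirl (curl (v t)))) x - 2 / (x 0 ^ 2 + x 1 ^ 2) *
        fderiv ℝ (swirl (curl (v t))) x
          ((x 0) • EuclideanSpace.single 0 1 + (x 1) • EuclideanSpace.single 1 1) := by
    have e : fderiv ℝ (curl (v t)) x (EuclideanSpace.single 0 1) 1 -
        fderiv ℝ (curl (v t)) x (EuclideanSpace.single 1 1) 0 =
        1 / (x 0 ^ 2 + x 1 ^ 2) * fderiv ℝ (swirl (curl (v t))) x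
          ((x 0) • EuclideanSpace.single 0 1 + (x 1) • EuclideanSpace.single 1 1) := by
      rw [sq_add_sq_eq_cylRadius_sq]
      have h' : fderiv ℝ (swirl (curl (v t))) x
          ((x 0) • EuclideanSpace.single 0 1 + (x 1) • EuclideanSpace.single 1 1) =
          cylRadius x ^ 2 * (fderiv ℝ (curl (v t)) x (EuclideanSpace.single 0 1) 1 -
            fderiv ℝ (curl (v t)) x (EuclideanSpace.single 1 1) 0) := by
        have h2 := congrArg (fun y => cylRadius x * y) hrad
        simp only [] at h2
        rw [← mul_assoc, mul_inv_cancel₀ hx, one_mul] at h2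
        rw [h2]
        ring
      rw [h']
      field_simp
    rw [hlap, e]
    ring
  -- (iii) the source: Lagrange `ρ ⟪Ju, ω⟫ = ρW · ρΩ − ρΦ · ρJ`
  have hsrc : ⟪rotGen (v t x), curl (v t) x⟫ =
      (x 0 ^ 2 + x 1 ^ 2) * (radVelQuot (v t) x * angVortQuot (v t) x -
        angVelQuot (v t) x * radVelQuot (curl (v t)) x) := by
    have hL := cylRadius_sq_mul_inner_rotGen x (v t x) (curl (v t) x)
    rw [inner_toLp_horizontal_left, inner_toLp_horizontal_left,
      ← haxt.cylRadius_sq_mul_radVelQuot hv2 x, ← haxω.cylRadius_sq_mul_radVelQuot hω2 x] at hL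
    have e1 : ⟪rotGen x, curl (v t) x⟫ = cylRadius x ^ 2 * angVortQuot (v t) x := by
      rw [haxt.cylRadius_sq_mul_angVortQuot hv3 x, swirl_eq_inner_rotGen]
    have e2 : ⟪rotGen x, v t x⟫ = cylRadius x ^ 2 * angVelQuot (v t) x := by
      rw [haxt.cylRadius_sq_mul_angVelQuot hv2 x, swirl_eq_inner_rotGen]
    rw [e1, e2] at hL
    rw [sq_add_sq_eq_cylRadius_sq]
    have hr2 : cylRadius x ^ 2 ≠ 0 := pow_ne_zero 2 hx
    apply mul_left_cancel₀ hr2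
    rw [hL]
    ring
  -- `Σ = ρ Ω` as functions
  have hSig : swirl (curl (v t)) = fun y => (y 0 ^ 2 + y 1 ^ 2) * angVortQuot (v t) y := by
    funext y
    rw [sq_add_sq_eq_cylRadius_sq, haxt.cylRadius_sq_mul_angVortQuot hv3 y]
  rw [ht1, hvisc, hsrc, hSig] at hpde
  -- the template, with `R = 2 ρ (WΩ − ΦJ)`
  have key := template_quotient_eq hΩ hρx (ν := ν)
    (R := 2 * ((x 0 ^ 2 + x 1 ^ 2) * (radVelQuot (v t) x * angVortQuot (v t) x -
      angVelQuot (v t) x * radVelQuot (curl (v t)) x))) (c := v t x)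
    (σ' := angVortQuot (timeDerivWithin S v t) x) (by linarith [hpde])
  rw [fderiv_apply_horizontal_eq hΩ hΩax, ← sq_add_sq_eq_cylRadius_sq,
    ← haxt.cylRadius_sq_mul_radVelQuot hv2 x, ← sq_add_sq_eq_cylRadius_sq] at key
  have e1 : 2 * angVortQuot (v t) x * ((x 0 ^ 2 + x 1 ^ 2) * radVelQuot (v t) x) /
      (x 0 ^ 2 + x 1 ^ 2) = 2 * radVelQuot (v t) x * angVortQuot (v t) x := by
    field_simp
  have e2 : 2 / (x 0 ^ 2 + x 1 ^ 2) * ((x 0 ^ 2 + x 1 ^ 2) * radDerivQuot (angVortQuot (v t)) x) =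
      2 * radDerivQuot (angVortQuot (v t)) x := by
    field_simp
  have e3 : 2 * ((x 0 ^ 2 + x 1 ^ 2) * (radVelQuot (v t) x * angVortQuot (v t) x -
      angVelQuot (v t) x * radVelQuot (curl (v t)) x)) / (x 0 ^ 2 + x 1 ^ 2) =
      2 * (radVelQuot (v t) x * angVortQuot (v t) x -
        angVelQuot (v t) x * radVelQuot (curl (v t)) x) := by
    field_simp
  rw [e1, e2, e3] at key
  linarith

/-- **The `Ω`-equation on all of `ℝ³`** (Lei–Zhang 2017, (1.4)₂: `∂ₜΩ + (b·∇)Ω = (Δ + (2/r)∂ᵣ)Ω −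
2(v^θ/r)J`, `Ω = ω^θ/r`, `J = ωʳ/r`; Majda–Bertozzi (2.58)): for a classical solution of the
unforced system with viscosity `ν` on a time set `S ⊆ closure (interior S)` of unique
differentiability with axisymmetric velocity, at every `t ∈ S` and EVERY `x`,
`Ω'(x) + DΩ(x)[u] = ν (ΔΩ(x) + 2 radDerivQuot Ω (x)) − 2 Φ(x) J(x)` with
`Ω = angVortQuot (u t)`, `Ω' = angVortQuot (∂ₜu t)`, `Φ = angVelQuot (u t)`,
`J = radVelQuot (curl (u t))`. [cite: LeiZhang2017, §1 (1.4) (arXiv p. 4)] -/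
theorem IsClassicalNSSolutionOn.angVortQuot_eq (hns : IsClassicalNSSolutionOn S ν 0 v q)
    (hS : UniqueDiffOn ℝ S) (hcl : S ⊆ closure (interior S))
    (hax : ∀ s ∈ S, IsAxisymmetric (v s)) {t : ℝ} (ht : t ∈ S) (x : EuclideanSpace ℝ (Fin 3)) :
    angVortQuot (timeDerivWithin S v t) x + fderiv ℝ (angVortQuot (v t)) x (v t x) =
      ν * ((Δ (angVortQuot (v t))) x + 2 * radDerivQuot (angVortQuot (v t)) x) -
        2 * angVelQuot (v t) x * radVelQuot (curl (v t)) x := by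
  have hsm : IsSmoothSpaceTimeOn S v := hns.smooth_velocity
  have hv : ContDiff ℝ ∞ (v t) := hns.contDiff_velocity ht
  have hv4 : ContDiff ℝ 4 (v t) := hv.of_le (by norm_cast)
  have hv5 : ContDiff ℝ 5 (v t) := hv.of_le (by norm_cast)
  have hv6 : ContDiff ℝ 6 (v t) := hv.of_le (by norm_cast)
  have hdv : ContDiff ℝ ∞ (timeDerivWithin S v t) := hsm.contDiff_timeDerivWithin_slice hS ht
  have hdv5 : ContDiff ℝ 5 (timeDerivWithin S v t) := hdv.of_le (by norm_cast)
  have hω : ContDiff ℝ ∞ (curl (v t)) := by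
    rw [curl_eq_curlCLM_comp]
    exact curlCLM.contDiff.comp (hv.fderiv_right (m := ∞) (by simp))
  have hω4 : ContDiff ℝ 4 (curl (v t)) := hω.of_le (by norm_cast)
  have hΩ3 : ContDiff ℝ 3 (angVortQuot (v t)) := contDiff_angVortQuot (n := 3) hv6
  have hΩ2 : ContDiff ℝ 2 (angVortQuot (v t)) := contDiff_angVortQuot (n := 2) hv5
  have hΩ' : ContDiff ℝ 2 (angVortQuot (timeDerivWithin S v t)) := contDiff_angVortQuot (n := 2) hdv5
  have hΦ : ContDiff ℝ 2 (angVelQuot (v t)) := contDiff_angVelQuot (n := 2) hv4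
  have hJ : ContDiff ℝ 2 (radVelQuot (curl (v t))) := contDiff_radVelQuot (n := 2) hω4
  have hL : Continuous fun y => angVortQuot (timeDerivWithin S v t) y +
      fderiv ℝ (angVortQuot (v t)) y (v t y) :=
    hΩ'.continuous.add ((hΩ2.continuous_fderiv two_ne_zero).clm_apply hv.continuous)
  have hR : Continuous fun y => ν * ((Δ (angVortQuot (v t))) y +
      2 * radDerivQuot (angVortQuot (v t)) y) -
        2 * angVelQuot (v t) y * radVelQuot (curl (v t)) y := by
    refine (continuous_const.mul ((continuous_laplacian hΩ2).add
      (continuous_const.mul (continuous_radDerivQuot hΩ2)))).sub ?_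
    exact (continuous_const.mul hΦ.continuous).mul hJ.continuous
  refine eq_of_eq_off_ker (EuclideanSpace.proj (0 : Fin 3)) ⟨EuclideanSpace.single 0 1, by simp⟩
    hL hR (fun z hz => ?_) x
  have hz0 : z 0 ≠ 0 := by simpa using hz
  have hzr : cylRadius z ≠ 0 := fun h => hz0 ((cylRadius_eq_zero_iff z).1 h).1
  exact hns.angVortQuot_eq_of_ne hS hcl hax ht hzr

end OmegaEquation

end Literature.Analysis.FluidPDE

end
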